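import Literature.Barriers.SmoothPoincare4.ExoticOpenFourSpaceChernSimonsProofs
import Literature.Geometry.Kaehler.ConnectionCurvatureGauge
import Literature.Geometry.Kaehler.ChernWeilTransgressionPolynomial
import HarnessLib

/-!
# `deMichelisFreedman1992_continuum`: Thm. 2.1, Point 3, (2.16)–(2.18) — the self-dual curvature
# of the continuity-method path `a_t = t g a g⁻¹ + g d_A g⁻¹` between two ASD connections — and
# Appendix A, (A.5): the differential of the nonabelian Čech coboundary

Proof file in the cone of the named fact
`Literature.Barriers.SmoothPoincare4.deMichelisFreedman1992_continuum` (DeMichelis–Freedman 1992,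
Thm. 4.1 with Cor. 4.1: continuum many pairwise non-diffeomorphic open subsets of standard `ℝ⁴`,
each homeomorphic to `ℝ⁴`; `ExoticOpenFourSpace.lean`), sibling of
`ExoticOpenFourSpaceChernSimonsProofs` (Appendix B (B.4)–(B.5): `curvForm`, `frameVal`, the
frame form of anti-self-duality). What the cone leaves of the printed proof is the gauge theory of
Thm. 2.1 ("`Φ` commutes with geometric limit", pp. 224–233) with its Appendices A and B; THIS FILE
renders the two steps of the proof of **Point 3** of Thm. 2.1 and of **Appendix A** that are
ALGEBRA / elementary calculus of gauge transformations rather than analysis — the half-page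
computation (2.16)–(2.18), pp. 230–231, and the differential (A.5) of the Čech coboundary, p. 249.

Point 3 (p. 224): "Suppose the metric on `M_∞` is perturbed so that `H²` (deformation complex)
`= 0`. Let `A_n` and `A'_n` both converge in `C^∞` on compact sets to `A_∞`. Then for `n`
sufficiently large `A_n = A'_n` on `Q_n`." Its proof (pp. 229–232) writes `A'_n = A_n + a_n` and
improves a radial gauge to a Hodge gauge by the continuity method (p. 230, verbatim):

> "Dropping the "`n`" from our notation, we consider the problem of finding `g_t` so that `a_t`
> defined by (2.16) will also satisfy (2.14) and (2.15): (2.16) `a_t = t g_t a g_t⁻¹ + g_t d g_t⁻¹`.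
> When `t = 0`, `g_0 = 𝟙` is a solution; we want a solution for `t = 1`. […] We claim that `a_t`
> satisfies (2.17) `d⁺_{A_n} a_t + (a_t ∧ a_t)⁺ = t(t − 1)(g a ∧ a g⁻¹)⁺`. To verify this we
> expand: (2.18) `d_{A_n} a_t + a_t ∧ a_t = d_{A_n}(t g a g⁻¹ + g d_{A_n} g⁻¹) + (t g a g⁻¹ +
> g d_{A_n} g⁻¹) ∧ (t g a g⁻¹ + g d_{A_n} g⁻¹) =` [nine terms] `+ t² g a ∧ a g⁻¹`. Since
> `A'_n = A_n + a` is ASD, `d_{A_n} a⁺ = (−a ∧ a)⁺` so upon taking +-selfdual parts terms 2 and 5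
> above survive as desired; the others drop out. Terms 1 and 8 cancel as do terms 3 and 7, and 4
> and 9. Because `A_n` is ASD the + part of term 5 vanishes."

(`d` in (2.16) is the covariant derivative `d_{A_n}`, as (2.18) shows.) We PROVE (2.17), pointwise,
in a local frame of the bundle in which `A = A_n = d + b` (`b` an `r × r` matrix of `1`-forms; over
the end of `M_n` the bundle is trivialised, p. 223/229: "`A_∞ = d + a` near infinity, where `d` is
standard differentiation with respect to a trivialization at infinity"), for a gauge transformation
given near the point by a matrix-valued function `g = G` with inverse `K` (`G K = 𝟙` near `x`), in
the tree's calculus of matrices of forms on an arbitrary real `C^∞` manifold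
(`Literature.Geometry.Kaehler.MatrixForm`; any model with corners, any rank, complex matrices —
`SO(3) ⊂ U(3)`), by the conceptual route whose coordinate expansion IS (2.18):

* `covD b a = da + b ∧ a + a ∧ b` — the covariant exterior derivative `d_A a` of an `End`-valued
  `1`-form in the frame (Labastida–Mariño (2.41): "The condition we obtain on `a` starting from
  `F⁺_{A+a} = 0` is `p⁺(∇_A a + a ∧ a) = 0`"); `covDFun b u = du + b u − u b` — `d_A u = du + [A, u]`
  of an `End`-valued function (Labastida–Mariño (2.5));
* `curvForm_add_apply`, `curvForm_add_smul_apply` — **the affine expansion of the curvature**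
  `F_{A+a} = F_A + d_A a + a ∧ a`, `F_{A+ta} = F_A + t d_A a + t² a ∧ a` at every point where the
  forms are smooth (`curvForm a = da + a ∧ a` of `ExoticOpenFourSpaceChernSimonsProofs`);
* `add_continuityPath_eventuallyEq` — **(2.16) is a gauge transform**: if
  `a_t = t G a K + G (covDFun b K)` near `x` (the printed `t g a g⁻¹ + g d_A g⁻¹`, `g⁻¹ = K`) and
  `G K = 𝟙` near `x`, then `b + a_t = G (b + t a) K + G dK` near `x`, i.e. `A + a_t = g · (A + t a)`
  (Labastida–Mariño (2.4) `u*(A) = u A u⁻¹ + (du⁻¹… ) = A + (∇_A u)u⁻¹`-form of the gauge action);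
* `curvForm_continuityPath_apply` — by **gauge covariance of the curvature** (the tree's
  `MatrixForm.gauge_curvature_apply`, Kobayashi I (1.17) / Labastida–Mariño (2.6)
  `u*(F) = u F u⁻¹`): `F_{A + a_t}(x) = (G (F_A + t d_A a + t² a ∧ a) K)(x)` — the un-projected
  form of (2.17)/(2.18): in (2.18) "terms 1 and 8, 3 and 7, 4 and 9 cancel" is `dG = −G dK G`
  inside the gauge-covariance computation, and "terms 2 and 5 survive" are `t g (d_A a) g⁻¹` and
  `t² g (a ∧ a) g⁻¹`;
* `sdFrameVal F x e = (F₀₁ + F₂₃, F₀₂ + F₃₁, F₀₃ + F₁₂)` — the three self-dual combinations of the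
  frame components of a matrix of `2`-forms on four tangent vectors `e` at `x`, so that
  **`F⁺ = 0` in the frame** is `sdFrameVal F x e = 0` (Labastida–Mariño (2.19); the hypothesis
  form of `trace_wedge_self_apply_frame_of_asd`), with its linearity and conjugation-equivariance
  `sdFrameVal (G F K) = G(x) · sdFrameVal F · K(x)`;
* `sdFrameVal_covD_eq_neg` — **"Since `A' = A + a` is ASD, `d_A a⁺ = (−a ∧ a)⁺`"** (given that
  `A` is ASD too);
* `sdFrameVal_continuityPath` — **(2.17)**: if `F_A⁺ = 0` and `F_{A+a}⁺ = 0` in the frame at `x`,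
  then `(d_A a_t + a_t ∧ a_t)⁺ = t(t − 1) (G (a ∧ a) K)⁺ there.

Appendix A ("Gauges for low energy connections", pp. 248–251) glues Uhlenbeck's local Coulomb
gauges `g_α` on a finite convex cover `{U_α}` into a global gauge; its Claim (A.3) averages the
transition cochain `g_αβ = g_α⁻¹ g_β` and gauges the average back to a cocycle using (p. 249,
verbatim): "We are interested in the coboundary map `rG¹_δ → G²_δ` […] The differential of the
coboundary at the identity is well known to be (A.5) `{h_αβ} → {h_αβ + h_βγ − h_αγ}`. (Think of `h`
as identified by logarithms with an element of the Lie algebra `so(3)`.)" We PROVE (A.5) for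
cochains with values in an arbitrary normed algebra `𝔸` with summable geometric series (e.g. any
complete normed algebra; `SO(3) ⊂ M₃(ℝ)`, the Lie algebra directions being among all directions):

* `cechCoboundary g α β γ = g_αβ g_βγ g_αγ⁻¹` — the nonabelian Čech coboundary of a `1`-cochain
  (`Ring.inverse` for the inverse); `cechCoboundaryDeriv` — the abelian coboundary
  `{h_αβ} ↦ {h_αβ + h_βγ − h_αγ}` as a continuous linear map;
* `hasFDerivAt_cechCoboundary_apply`, `hasFDerivAt_cechCoboundary` — **(A.5)**: the Fréchet
  derivative of `cechCoboundary` at the identity cochain is `cechCoboundaryDeriv` (product rule and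
  `D(x⁻¹)|_{x=1} = −id`, Mathlib's `hasFDerivAt_ringInverse`).

NOT rendered: the analysis of Point 3 around (2.17) — the continuity method itself (closedness via
compactness of `SO(3)` and elliptic regularity, openness via the implicit function theorem),
(2.19)–(2.22) (weighted `L²_δ` estimates, `λ₁ > 0`) — and Points 1, 2, 4; of Appendix A, everything
but (A.5) (Uhlenbeck's local gauges, the slice argument (A.6)–(A.7), the handlebody "Fact" of
p. 250); no named fact is introduced (D-0026).

## References

* S. DeMichelis, M. H. Freedman, *Uncountably many exotic `R⁴`'s in standard 4-space*,
  J. Differential Geom. 35 (1992) 219–254: Thm. 2.1, Point 3, (2.16)–(2.18), pp. 230–231;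
  Appendix A, (A.5), p. 249 [DeMichelisFreedman1992].
* J. Labastida, M. Mariño, *Topological Quantum Field Theory and Four Manifolds* (2005), §2.1
  (2.4)–(2.6) (gauge action on connections and curvature, `∇_A u = du + [A, u]`), §2.3 (2.19)
  (`F⁺ = 0` in a frame), §2.4 (2.41) (`F⁺_{A+a} = 0 ⟺ p⁺(∇_A a + a ∧ a) = 0`) [LabastidaMarino2005].
* S. Kobayashi, *Differential Geometry of Complex Vector Bundles* (1987), Ch. I §1 (1.12),
  (1.16)–(1.17) [Kobayashi1987].

[DeMichelisFreedman1992]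
-/

noncomputable section

open scoped Manifold ContDiff Topology Matrix
open Set Filter
open Literature.Geometry.Kaehler

namespace Literature.Barriers.SmoothPoincare4

variable {E : Type*} [NormedAddCommGroup E] [NormedSpace ℝ E]
  {H : Type*} [TopologicalSpace H] {I : ModelWithCorners ℝ E H}
  {M : Type*} [TopologicalSpace M] [ChartedSpace H M] {r k l : ℕ}

/-! ### Covariant derivatives in a frame -/

/-- **The covariant exterior derivative `d_A a = da + b ∧ a + a ∧ b`** of an `End`-valued `1`-form
`a` (an `r × r` matrix of `1`-forms) with respect to the connection `A = d + b` in a frame — the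
`∇_A a` of Labastida–Mariño (2.41) "`F⁺_{A+a} = 0` is `p⁺(∇_A a + a ∧ a) = 0`", DeMichelis–Freedman's
`d_{A_n} a` in (2.17)–(2.18). [cite: LabastidaMarino2005, §2.4 (2.41)] -/
def covD (b a : MatrixForm I M r 1) : MatrixForm I M r 2 :=
  a.d + (b.wedge a + a.wedge b)

/-- Unfolding `covD`. [folklore] -/
theorem covD_def (b a : MatrixForm I M r 1) : covD b a = a.d + (b.wedge a + a.wedge b) := rfl

/-- **The covariant derivative `d_A u = du + b u − u b = du + [b, u]`** of an `End`-valued function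
`u` (a matrix-valued function) with respect to `A = d + b` in a frame (Labastida–Mariño (2.5)
`∇_A u = du + i[A, u]`, without the physicists' `i`); DeMichelis–Freedman's `d_{A_n} g⁻¹` in
(2.16)/(2.18). The differential `du = (ofFun u).d` has degree `0 + 1`, which is `1`.
[cite: LabastidaMarino2005, §2.1 (2.5)] -/
def covDFun (b : MatrixForm I M r 1) (u : M → Matrix (Fin r) (Fin r) ℂ) : MatrixForm I M r 1 :=
  (b.mulRight u - MatrixForm.mulLeft u b) + (MatrixForm.ofFun (I := I) u).d

/-- Unfolding `covDFun`. [folklore] -/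
theorem covDFun_def (b : MatrixForm I M r 1) (u : M → Matrix (Fin r) (Fin r) ℂ) :
    covDFun b u = (b.mulRight u - MatrixForm.mulLeft u b) + (MatrixForm.ofFun (I := I) u).d := rfl

/-! ### Real scalars -/

/-- `d_A (t a) = t d_A a` for a real scalar `t` (the tree's `MatrixForm.d_smul`, `smul_wedge`,
`wedge_smul`). [folklore] -/
theorem covD_smul (t : ℝ) (b a : MatrixForm I M r 1) : covD b (t • a) = t • covD b a := by
  simp only [covD_def, MatrixForm.d_smul, MatrixForm.wedge_smul, MatrixForm.smul_wedge, smul_add]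

/-! ### The affine expansion of the curvature -/

/-- **`F_{A+a} = F_A + d_A a + a ∧ a`** in a frame, at every point where `b` and `a` are smooth:
`curvForm (b + a)(x) = (curvForm b + covD b a + a ∧ a)(x)` (`curvForm w = dw + w ∧ w`; the identity
behind Labastida–Mariño (2.41) and the starting point of DeMichelis–Freedman's (2.18)).
[cite: LabastidaMarino2005, §2.4 (2.41)] -/
theorem curvForm_add_apply {b a : MatrixForm I M r 1} {x : M}
    (hb : ∀ c d, (b c d).SmoothAt x) (ha : ∀ c d, (a c d).SmoothAt x) (c d : Fin r) :
    curvForm (b + a) c d x = (curvForm b + covD b a + a.wedge a) c d x := by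
  simp only [curvForm_def, covD_def, MatrixForm.add_wedge, MatrixForm.wedge_add, Matrix.add_apply,
    Pi.add_apply]
  rw [MatrixForm.d_add_apply hb ha]
  abel

/-- **`F_{A+ta} = F_A + t d_A a + t² a ∧ a`** in a frame (`t` real), at every point where `b` and
`a` are smooth — the curvature of the connection `A + t a` whose gauge transform is `A + a_t`
((2.16); "terms 2 and 5" of (2.18) are `g (t d_A a) g⁻¹` and `t² g a ∧ a g⁻¹`).
[cite: DeMichelisFreedman1992, §2 (2.18), p. 231] -/
theorem curvForm_add_smul_apply (t : ℝ) {b a : MatrixForm I M r 1} {x : M}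
    (hb : ∀ c d, (b c d).SmoothAt x) (ha : ∀ c d, (a c d).SmoothAt x) (c d : Fin r) :
    curvForm (b + t • a) c d x = (curvForm b + t • covD b a + (t ^ 2) • a.wedge a) c d x := by
  have hta : ∀ c d, ((t • a) c d).SmoothAt x := fun c d ↦ by
    rw [Matrix.smul_apply]
    exact (ha c d).smul t
  rw [curvForm_add_apply hb hta, covD_smul, MatrixForm.smul_wedge, MatrixForm.wedge_smul, smul_smul,
    sq]

/-- **`d_A a + a ∧ a = F_{A+a} − F_A`** at a point where `b` and `a` are smooth (the left-hand
side of (2.17)/(2.18) as a difference of curvatures). [cite: DeMichelisFreedman1992, §2 (2.18), p. 231] -/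
theorem covD_add_wedge_apply {b a : MatrixForm I M r 1} {x : M}
    (hb : ∀ c d, (b c d).SmoothAt x) (ha : ∀ c d, (a c d).SmoothAt x) (c d : Fin r) :
    (covD b a + a.wedge a) c d x = curvForm (b + a) c d x - curvForm b c d x := by
  rw [curvForm_add_apply hb ha]
  simp only [Matrix.add_apply, Pi.add_apply]
  abel

/-! ### Gauge covariance and the continuity-method path (2.16) -/

section Gauge

variable [IsManifold I ∞ M]

/-- **Gauge covariance of the curvature, `F_{g·A} = g F_A g⁻¹`** (Kobayashi I (1.17);
Labastida–Mariño (2.6) `u*(F) = u F u⁻¹`), in the form of the tree's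
`MatrixForm.gauge_curvature_apply`: if near `x` the matrix of `1`-forms `P` equals
`G w K + G dK` with `G K = 𝟙` near `x` and `K(x) G(x) = 𝟙`, then
`curvForm P (x) = (G (curvForm w) K)(x)`. [cite: Kobayashi1987, Ch. I §1 (1.17)] -/
theorem curvForm_gauge_apply {w P : MatrixForm I M r 1} {G K : M → Matrix (Fin r) (Fin r) ℂ}
    {x : M} (hw : ∀ c d, (w c d).SmoothAt x)
    (hG : ∀ c d, ContMDiffAt I 𝓘(ℝ, ℂ) ∞ (fun y ↦ G y c d) x)
    (hK : ∀ᶠ y in 𝓝 x, ∀ c d, ContMDiffAt I 𝓘(ℝ, ℂ) ∞ (fun y ↦ K y c d) y)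
    (hGK : ∀ᶠ y in 𝓝 x, G y * K y = 1) (hKG : K x * G x = 1)
    (hP : ∀ c d, ∀ᶠ y in 𝓝 x, P c d y =
      ((MatrixForm.mulLeft G w).mulRight K + MatrixForm.mulLeft G (MatrixForm.ofFun (I := I) K).d) c d y)
    (c d : Fin r) :
    curvForm P c d x = MatrixForm.mulLeft G ((curvForm w).mulRight K) c d x :=
  MatrixForm.gauge_curvature_apply hw hG hK hGK hKG hP c d

omit [IsManifold I ∞ M] in
/-- **(2.16) is a gauge transformation: `A + a_t = g · (A + t a)`.** If near `x` the matrix of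
`1`-forms `aT` is the printed `a_t = t g a g⁻¹ + g d_A g⁻¹`, i.e.
`aT = t G a K + G (covDFun b K)` with `K = g⁻¹` (`G K = 𝟙` near `x`), then near `x`
`b + aT = G (b + t a) K + G dK` — the connection matrix of the gauge transform of `A + t a = d + (b + t a)`
by `g` (Labastida–Mariño (2.4) `u*(A) = u A u⁻¹ + (du) u⁻¹`-type law, here as
`g·w = G w K + G dK`, Kobayashi I (1.16)). [cite: DeMichelisFreedman1992, §2 (2.16), p. 230] -/
theorem add_continuityPath_eventuallyEq {b a aT : MatrixForm I M r 1}
    {G K : M → Matrix (Fin r) (Fin r) ℂ} {x : M} (t : ℝ) (hGK : ∀ᶠ y in 𝓝 x, G y * K y = 1)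
    (haT : ∀ c d, ∀ᶠ y in 𝓝 x, aT c d y =
      (t • MatrixForm.mulLeft G (a.mulRight K) + MatrixForm.mulLeft G (covDFun b K)) c d y)
    (c d : Fin r) :
    ∀ᶠ y in 𝓝 x, (b + aT) c d y =
      ((MatrixForm.mulLeft G (b + t • a)).mulRight K +
        MatrixForm.mulLeft G (MatrixForm.ofFun (I := I) K).d) c d y := by
  filter_upwards [hGK, haT c d] with y hy haTy
  have hb : MatrixForm.mulLeft G (MatrixForm.mulLeft K b) c d y = b c d y := by
    rw [MatrixForm.mulLeft_mulLeft]
    exact MatrixForm.mulLeft_apply_of_eq_one (g := G * K) hy b c d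
  rw [Matrix.add_apply, Pi.add_apply, haTy, covDFun_def, sub_eq_add_neg, MatrixForm.mulLeft_add,
    MatrixForm.mulLeft_add, MatrixForm.mulLeft_add, MatrixForm.mulLeft_neg, MatrixForm.mulRight_add,
    MatrixForm.mulLeft_smul, MatrixForm.smul_mulRight, MatrixForm.mulLeft_mulRight,
    MatrixForm.mulLeft_mulRight]
  simp only [Matrix.add_apply, Pi.add_apply, Matrix.neg_apply, Pi.neg_apply, Matrix.smul_apply,
    Pi.smul_apply, hb]
  abel

/-- **Smoothness of the path at `x`**: with `b`, `a` smooth at `x`, `G` smooth at `x` and `K`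
smooth near `x`, the printed `a_t = t g a g⁻¹ + g d_A g⁻¹` is smooth at `x`. [folklore] -/
theorem smoothAt_continuityPath {b a aT : MatrixForm I M r 1}
    {G K : M → Matrix (Fin r) (Fin r) ℂ} {x : M} (t : ℝ)
    (hb : ∀ c d, (b c d).SmoothAt x) (ha : ∀ c d, (a c d).SmoothAt x)
    (hG : ∀ c d, ContMDiffAt I 𝓘(ℝ, ℂ) ∞ (fun y ↦ G y c d) x)
    (hK : ∀ᶠ y in 𝓝 x, ∀ c d, ContMDiffAt I 𝓘(ℝ, ℂ) ∞ (fun y ↦ K y c d) y)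
    (haT : ∀ c d, ∀ᶠ y in 𝓝 x, aT c d y =
      (t • MatrixForm.mulLeft G (a.mulRight K) + MatrixForm.mulLeft G (covDFun b K)) c d y)
    (c d : Fin r) : (aT c d).SmoothAt x := by
  have hKx : ∀ c d, ContMDiffAt I 𝓘(ℝ, ℂ) ∞ (fun y ↦ K y c d) x := hK.self_of_nhds
  have hdK : ∀ c d, ((MatrixForm.ofFun (I := I) K).d c d).SmoothAt x := fun c d ↦ by
    rw [MatrixForm.d_apply]
    exact MForm.SmoothAt.mextDeriv (hK.mono fun y hy ↦ MatrixForm.smoothAt_ofFun hy c d)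
  have h1 : ∀ c d, ((t • MatrixForm.mulLeft G (a.mulRight K)) c d).SmoothAt x := fun c d ↦ by
    rw [Matrix.smul_apply]
    exact (MatrixForm.smoothAt_mulLeft hG (MatrixForm.smoothAt_mulRight ha hKx) c d).smul t
  have h2 : ∀ c d, (covDFun b K c d).SmoothAt x := fun c d ↦ by
    rw [covDFun_def, Matrix.add_apply, Matrix.sub_apply]
    exact ((MatrixForm.smoothAt_mulRight hb hKx c d).sub
      (MatrixForm.smoothAt_mulLeft hKx hb c d)).add (hdK c d)
  have h3 : ((t • MatrixForm.mulLeft G (a.mulRight K) + MatrixForm.mulLeft G (covDFun b K)) c d).SmoothAt x := by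
    rw [Matrix.add_apply]
    exact (h1 c d).add (MatrixForm.smoothAt_mulLeft hG h2 c d)
  exact h3.congr_of_eventuallyEq ((haT c d).mono fun y hy ↦ hy.symm)

/-- **The curvature of `A + a_t`, un-projected form of (2.17)/(2.18)**: for the printed path
`a_t = t g a g⁻¹ + g d_A g⁻¹` (near `x`, with `g = G`, `g⁻¹ = K`, `G K = 𝟙` near `x`,
`K(x) G(x) = 𝟙`, everything smooth), `F_{A+a_t}(x) = (G (F_A + t d_A a + t² a ∧ a) K)(x)` —
gauge covariance applied to `A + a_t = g · (A + t a)` and the affine expansion of `F_{A+ta}`; the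
nine terms of (2.18) with "terms 1 and 8 cancel as do terms 3 and 7, and 4 and 9" are this
computation in coordinates. [cite: DeMichelisFreedman1992, §2 (2.18), p. 231] -/
theorem curvForm_continuityPath_apply {b a aT : MatrixForm I M r 1}
    {G K : M → Matrix (Fin r) (Fin r) ℂ} {x : M} (t : ℝ)
    (hb : ∀ c d, (b c d).SmoothAt x) (ha : ∀ c d, (a c d).SmoothAt x)
    (hG : ∀ c d, ContMDiffAt I 𝓘(ℝ, ℂ) ∞ (fun y ↦ G y c d) x)
    (hK : ∀ᶠ y in 𝓝 x, ∀ c d, ContMDiffAt I 𝓘(ℝ, ℂ) ∞ (fun y ↦ K y c d) y)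
    (hGK : ∀ᶠ y in 𝓝 x, G y * K y = 1) (hKG : K x * G x = 1)
    (haT : ∀ c d, ∀ᶠ y in 𝓝 x, aT c d y =
      (t • MatrixForm.mulLeft G (a.mulRight K) + MatrixForm.mulLeft G (covDFun b K)) c d y)
    (c d : Fin r) :
    curvForm (b + aT) c d x =
      MatrixForm.mulLeft G ((curvForm b + t • covD b a + (t ^ 2) • a.wedge a).mulRight K) c d x := by
  have hw : ∀ c d, ((b + t • a) c d).SmoothAt x := fun c d ↦ by
    rw [Matrix.add_apply, Matrix.smul_apply]
    exact (hb c d).add ((ha c d).smul t)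
  rw [curvForm_gauge_apply hw hG hK hGK hKG (add_continuityPath_eventuallyEq t hGK haT) c d]
  exact MatrixForm.mulLeft_apply_congr_right G fun e ↦
    MatrixForm.mulRight_apply_congr_left K fun f ↦ curvForm_add_smul_apply t hb ha e f

end Gauge

/-! ### Self-dual parts in a frame -/

/-- **The three self-dual combinations** of the frame components `F_pq = F(e_p, e_q)` of a matrix
of `2`-forms on four tangent vectors `e` at `x`: `(F₀₁ + F₂₃, F₀₂ + F₃₁, F₀₃ + F₁₂)`; **`F⁺ = 0` in
the frame `e` at `x` is `sdFrameVal F x e = 0`** (Labastida–Mariño (2.19) `F₁₂ + F₃₄ = F₁₄ + F₂₃ =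
F₁₃ + F₄₂ = 0` for a positive orthonormal frame; the hypotheses of
`trace_wedge_self_apply_frame_of_asd`). [cite: LabastidaMarino2005, §2.3 (2.19)] -/
def sdFrameVal (F : MatrixForm I M r 2) (x : M) (e : Fin 4 → E) : Fin 3 → Matrix (Fin r) (Fin r) ℂ :=
  ![frameVal F x e 0 1 + frameVal F x e 2 3, frameVal F x e 0 2 + frameVal F x e 3 1,
    frameVal F x e 0 3 + frameVal F x e 1 2]

/-- The first self-dual combination `F₀₁ + F₂₃`. [folklore] -/
@[simp] theorem sdFrameVal_zero (F : MatrixForm I M r 2) (x : M) (e : Fin 4 → E) :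
    sdFrameVal F x e 0 = frameVal F x e 0 1 + frameVal F x e 2 3 := rfl

/-- The second self-dual combination `F₀₂ + F₃₁`. [folklore] -/
@[simp] theorem sdFrameVal_one (F : MatrixForm I M r 2) (x : M) (e : Fin 4 → E) :
    sdFrameVal F x e 1 = frameVal F x e 0 2 + frameVal F x e 3 1 := rfl

/-- The third self-dual combination `F₀₃ + F₁₂`. [folklore] -/
@[simp] theorem sdFrameVal_two (F : MatrixForm I M r 2) (x : M) (e : Fin 4 → E) :
    sdFrameVal F x e 2 = frameVal F x e 0 3 + frameVal F x e 1 2 := rfl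

/-- `frameVal` only depends on the values of the entries at `x`. [folklore] -/
theorem frameVal_congr {F G : MatrixForm I M r 2} {x : M} (h : ∀ c f, F c f x = G c f x)
    (e : Fin 4 → E) (p q : Fin 4) : frameVal F x e p q = frameVal G x e p q := by
  ext c f
  simp only [frameVal_apply, h]

/-- `frameVal` is additive. [folklore] -/
theorem frameVal_add (F G : MatrixForm I M r 2) (x : M) (e : Fin 4 → E) (p q : Fin 4) :
    frameVal (F + G) x e p q = frameVal F x e p q + frameVal G x e p q := by
  ext c f
  simp only [frameVal_apply, Matrix.add_apply, Pi.add_apply, ContinuousAlternatingMap.add_apply]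

/-- `frameVal` commutes with subtraction. [folklore] -/
theorem frameVal_sub (F G : MatrixForm I M r 2) (x : M) (e : Fin 4 → E) (p q : Fin 4) :
    frameVal (F - G) x e p q = frameVal F x e p q - frameVal G x e p q := by
  ext c f
  simp only [frameVal_apply, Matrix.sub_apply, Pi.sub_apply, ContinuousAlternatingMap.sub_apply]

/-- `frameVal` commutes with real scalars. [folklore] -/
theorem frameVal_smul (t : ℝ) (F : MatrixForm I M r 2) (x : M) (e : Fin 4 → E) (p q : Fin 4) :
    frameVal (t • F) x e p q = t • frameVal F x e p q := by
  ext c f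
  simp only [frameVal_apply, Matrix.smul_apply, Pi.smul_apply, ContinuousAlternatingMap.smul_apply]

/-- `frameVal (G · F) = G(x) frameVal F` (conjugation acts on the matrix factor). [folklore] -/
theorem frameVal_mulLeft (G : M → Matrix (Fin r) (Fin r) ℂ) (F : MatrixForm I M r 2) (x : M)
    (e : Fin 4 → E) (p q : Fin 4) : frameVal (MatrixForm.mulLeft G F) x e p q = G x * frameVal F x e p q := by
  ext c f
  simp only [frameVal_apply, MatrixForm.mulLeft_apply, ContinuousAlternatingMap.sum_apply,
    ContinuousAlternatingMap.smul_apply, smul_eq_mul, Matrix.mul_apply]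

/-- `frameVal (F · K) = frameVal F K(x)`. [folklore] -/
theorem frameVal_mulRight (F : MatrixForm I M r 2) (K : M → Matrix (Fin r) (Fin r) ℂ) (x : M)
    (e : Fin 4 → E) (p q : Fin 4) : frameVal (F.mulRight K) x e p q = frameVal F x e p q * K x := by
  ext c f
  simp only [frameVal_apply, MatrixForm.mulRight_apply, ContinuousAlternatingMap.sum_apply,
    ContinuousAlternatingMap.smul_apply, smul_eq_mul, Matrix.mul_apply]
  exact Finset.sum_congr rfl fun c' _ ↦ mul_comm _ _

/-- `sdFrameVal` only depends on the values of the entries at `x`. [folklore] -/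
theorem sdFrameVal_congr {F G : MatrixForm I M r 2} {x : M} (h : ∀ c f, F c f x = G c f x)
    (e : Fin 4 → E) : sdFrameVal F x e = sdFrameVal G x e := by
  funext i
  fin_cases i <;> simp [frameVal_congr h]

/-- `sdFrameVal` is additive (the self-dual projection is linear). [folklore] -/
theorem sdFrameVal_add (F G : MatrixForm I M r 2) (x : M) (e : Fin 4 → E) :
    sdFrameVal (F + G) x e = sdFrameVal F x e + sdFrameVal G x e := by
  funext i
  fin_cases i <;> simp [frameVal_add] <;> abel

/-- `sdFrameVal` commutes with subtraction. [folklore] -/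
theorem sdFrameVal_sub (F G : MatrixForm I M r 2) (x : M) (e : Fin 4 → E) :
    sdFrameVal (F - G) x e = sdFrameVal F x e - sdFrameVal G x e := by
  funext i
  fin_cases i <;> simp [frameVal_sub] <;> abel

/-- `sdFrameVal` commutes with real scalars. [folklore] -/
theorem sdFrameVal_smul (t : ℝ) (F : MatrixForm I M r 2) (x : M) (e : Fin 4 → E) :
    sdFrameVal (t • F) x e = t • sdFrameVal F x e := by
  funext i
  fin_cases i <;> simp [frameVal_smul, smul_add]

/-- **Conjugation-equivariance of the self-dual part: `(g F g⁻¹)⁺ = g F⁺ g⁻¹`** in the frame —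
`sdFrameVal (G · F · K) x e i = G(x) (sdFrameVal F x e i) K(x)` (the projection acts on the form
factor, conjugation on the matrix factor). [folklore] -/
theorem sdFrameVal_mulLeft_mulRight (G K : M → Matrix (Fin r) (Fin r) ℂ) (F : MatrixForm I M r 2)
    (x : M) (e : Fin 4 → E) (i : Fin 3) :
    sdFrameVal (MatrixForm.mulLeft G (F.mulRight K)) x e i = G x * sdFrameVal F x e i * K x := by
  fin_cases i <;> simp [frameVal_mulLeft, frameVal_mulRight, Matrix.mul_add, Matrix.add_mul,
    Matrix.mul_assoc]

/-! ### (2.17) -/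

/-- **"Since `A'_n = A_n + a` is ASD, `d_{A_n} a⁺ = (−a ∧ a)⁺`"** (p. 231; with `A_n` ASD as
well): if `F_A⁺ = 0` and `F_{A+a}⁺ = 0` in the frame `e` at a point `x` where `b`, `a` are smooth,
then `(d_A a)⁺ = −(a ∧ a)⁺` there. [cite: DeMichelisFreedman1992, §2 (2.18), p. 231] -/
theorem sdFrameVal_covD_eq_neg {b a : MatrixForm I M r 1} {x : M}
    (hb : ∀ c d, (b c d).SmoothAt x) (ha : ∀ c d, (a c d).SmoothAt x) (e : Fin 4 → E)
    (hA : sdFrameVal (curvForm b) x e = 0) (hA' : sdFrameVal (curvForm (b + a)) x e = 0) :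
    sdFrameVal (covD b a) x e = -sdFrameVal (a.wedge a) x e := by
  have h : sdFrameVal (curvForm (b + a)) x e = sdFrameVal (curvForm b + covD b a + a.wedge a) x e :=
    sdFrameVal_congr (fun c f ↦ curvForm_add_apply hb ha c f) e
  rw [hA', sdFrameVal_add, sdFrameVal_add, hA, zero_add] at h
  exact eq_neg_of_add_eq_zero_left h.symm

/-- **DeMichelis–Freedman (2.17): `d⁺_A a_t + (a_t ∧ a_t)⁺ = t(t − 1)(g a ∧ a g⁻¹)⁺`.** In a frame
in which `A = A_n = d + b` and `A'_n = A + a`, at a point `x` where `b`, `a` are smooth, for a gauge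
transformation `g = G` with inverse `K` near `x` (`G K = 𝟙` near `x`, `K(x) G(x) = 𝟙`, both
smooth) and the printed path `a_t = t g a g⁻¹ + g d_A g⁻¹` (2.16) (near `x`): if `F_A⁺ = 0` and
`F_{A'}⁺ = 0` in the frame `e` at `x`, then the three self-dual combinations of `d_A a_t + a_t ∧ a_t`
at `x` are `t(t − 1)` times those of `G (a ∧ a) K`. Proof as printed, organised conceptually:
`d_A a_t + a_t ∧ a_t = F_{A+a_t} − F_A`, `F_{A+a_t} = g F_{A+ta} g⁻¹` (gauge covariance; "terms 1
and 8, 3 and 7, 4 and 9 cancel"), `F_{A+ta} = F_A + t d_A a + t² a ∧ a` ("terms 2 and 5 survive"),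
`F_A⁺ = 0` ("the + part of term 5 vanishes" for the `F_A` inside) and `(d_A a)⁺ = −(a ∧ a)⁺`
("since `A'_n` is ASD"), whence `t² − t = t(t − 1)`. [cite: DeMichelisFreedman1992, §2 (2.17), p. 230] -/
theorem sdFrameVal_continuityPath [IsManifold I ∞ M] {b a aT : MatrixForm I M r 1}
    {G K : M → Matrix (Fin r) (Fin r) ℂ} {x : M} (t : ℝ)
    (hb : ∀ c d, (b c d).SmoothAt x) (ha : ∀ c d, (a c d).SmoothAt x)
    (hG : ∀ c d, ContMDiffAt I 𝓘(ℝ, ℂ) ∞ (fun y ↦ G y c d) x)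
    (hK : ∀ᶠ y in 𝓝 x, ∀ c d, ContMDiffAt I 𝓘(ℝ, ℂ) ∞ (fun y ↦ K y c d) y)
    (hGK : ∀ᶠ y in 𝓝 x, G y * K y = 1) (hKG : K x * G x = 1)
    (haT : ∀ c d, ∀ᶠ y in 𝓝 x, aT c d y =
      (t • MatrixForm.mulLeft G (a.mulRight K) + MatrixForm.mulLeft G (covDFun b K)) c d y)
    (e : Fin 4 → E) (hA : sdFrameVal (curvForm b) x e = 0)
    (hA' : sdFrameVal (curvForm (b + a)) x e = 0) (i : Fin 3) :
    sdFrameVal (covD b aT + aT.wedge aT) x e i =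
      (t * (t - 1)) • (G x * sdFrameVal (a.wedge a) x e i * K x) := by
  have haTx : ∀ c d, (aT c d).SmoothAt x := smoothAt_continuityPath t hb ha hG hK haT
  -- `d_A a_t + a_t ∧ a_t = F_{A+a_t} − F_A` at `x`
  have h1 : sdFrameVal (covD b aT + aT.wedge aT) x e =
      sdFrameVal (curvForm (b + aT)) x e - sdFrameVal (curvForm b) x e := by
    rw [← sdFrameVal_sub]
    exact sdFrameVal_congr (fun c f ↦ by
      rw [covD_add_wedge_apply hb haTx, Matrix.sub_apply, Pi.sub_apply]) e
  -- `F_{A+a_t}(x) = G (F_A + t d_A a + t² a ∧ a) K (x)`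
  have h2 : sdFrameVal (curvForm (b + aT)) x e =
      sdFrameVal (MatrixForm.mulLeft G ((curvForm b + t • covD b a + (t ^ 2) • a.wedge a).mulRight K)) x e :=
    sdFrameVal_congr (fun c f ↦ curvForm_continuityPath_apply t hb ha hG hK hGK hKG haT c f) e
  have h3 := sdFrameVal_covD_eq_neg hb ha e hA hA'
  rw [h1, hA, sub_zero, h2, sdFrameVal_mulLeft_mulRight, sdFrameVal_add, sdFrameVal_add, hA,
    zero_add, sdFrameVal_smul, sdFrameVal_smul, h3]
  simp only [Pi.add_apply, Pi.smul_apply, Pi.neg_apply, smul_neg, Matrix.mul_add, Matrix.add_mul,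
    Matrix.mul_smul, Matrix.smul_mul, Matrix.mul_neg, Matrix.neg_mul, smul_neg]
  rw [mul_sub, mul_one, sub_smul, sq]
  abel

/-! ### Appendix A, (A.5): the differential of the nonabelian Čech coboundary at the identity -/

section CechCoboundary

open scoped RightActions

variable {𝕜 : Type*} [NontriviallyNormedField 𝕜] {𝔸 : Type*} [NormedRing 𝔸] [NormedAlgebra 𝕜 𝔸]
  {ι : Type*}

/-- **The nonabelian Čech coboundary of a `1`-cochain** `{g_αβ}` with values in (the units of) a
normed ring: `(δg)_{αβγ} = g_αβ g_βγ g_αγ⁻¹` (Appendix A, p. 249: "We are interested in the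
coboundary map `rG¹_δ → G²_δ`", for cochains on the finite convex cover `{U_α}` with values in the
structure group `SO(3) ⊂ M₃(ℝ)`; `Ring.inverse` is the inverse on units). A cochain `g` is a cocycle
iff `δg ≡ 𝟙`. [cite: DeMichelisFreedman1992, App. A (A.4)–(A.5), p. 249] -/
def cechCoboundary (g : ι → ι → 𝔸) (α β γ : ι) : 𝔸 :=
  g α β * g β γ * Ring.inverse (g α γ)

/-- Unfolding `cechCoboundary`. [folklore] -/
theorem cechCoboundary_apply (g : ι → ι → 𝔸) (α β γ : ι) :
    cechCoboundary g α β γ = g α β * g β γ * Ring.inverse (g α γ) := rfl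

/-- The identity cochain is a cocycle: `δ𝟙 = 𝟙`. [folklore] -/
theorem cechCoboundary_one (α β γ : ι) : cechCoboundary (1 : ι → ι → 𝔸) α β γ = 1 := by
  simp [cechCoboundary_apply]

variable (𝕜) in
/-- The `(α, β)` entry of a `1`-cochain, as a continuous linear map. [folklore] -/
abbrev cochainEntry (α β : ι) : (ι → ι → 𝔸) →L[𝕜] 𝔸 :=
  (ContinuousLinearMap.proj (R := 𝕜) (φ := fun _ : ι ↦ 𝔸) β).comp
    (ContinuousLinearMap.proj (R := 𝕜) (φ := fun _ : ι ↦ ι → 𝔸) α)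

/-- `cochainEntry α β h = h_αβ`. [folklore] -/
@[simp] theorem cochainEntry_apply (α β : ι) (h : ι → ι → 𝔸) : cochainEntry 𝕜 α β h = h α β := rfl

variable (𝕜) in
/-- **(A.5) as a continuous linear map**: `{h_αβ} ↦ {h_αβ + h_βγ − h_αγ}` — the abelian Čech
coboundary of a `1`-cochain with values in the ring (the Lie algebra directions included).
[cite: DeMichelisFreedman1992, App. A (A.5), p. 249] -/
def cechCoboundaryDeriv : (ι → ι → 𝔸) →L[𝕜] (ι → ι → ι → 𝔸) :=
  ContinuousLinearMap.pi fun α ↦ ContinuousLinearMap.pi fun β ↦ ContinuousLinearMap.pi fun γ ↦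
    cochainEntry 𝕜 α β + cochainEntry 𝕜 β γ - cochainEntry 𝕜 α γ

/-- `(δ'h)_{αβγ} = h_αβ + h_βγ − h_αγ`. [cite: DeMichelisFreedman1992, App. A (A.5), p. 249] -/
@[simp] theorem cechCoboundaryDeriv_apply (h : ι → ι → 𝔸) (α β γ : ι) :
    cechCoboundaryDeriv 𝕜 h α β γ = h α β + h β γ - h α γ := rfl

variable [Fintype ι]

/-- The entry maps are their own derivatives. [folklore] -/
theorem hasFDerivAt_cochainEntry (α β : ι) (g : ι → ι → 𝔸) :
    HasFDerivAt (fun g : ι → ι → 𝔸 ↦ g α β) (cochainEntry 𝕜 α β) g := by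
  have hβ : HasFDerivAt (fun f : ι → 𝔸 ↦ f β)
      (ContinuousLinearMap.proj (R := 𝕜) (φ := fun _ : ι ↦ 𝔸) β) (g α) :=
    hasFDerivAt_apply β (g α)
  have hα : HasFDerivAt (fun g : ι → ι → 𝔸 ↦ g α)
      (ContinuousLinearMap.proj (R := 𝕜) (φ := fun _ : ι ↦ ι → 𝔸) α) g :=
    hasFDerivAt_apply α g
  exact hβ.comp g hα

variable [HasSummableGeomSeries 𝔸]

/-- **(A.5), componentwise**: the Fréchet derivative at the identity cochain of
`g ↦ (δg)_{αβγ} = g_αβ g_βγ g_αγ⁻¹` is `h ↦ h_αβ + h_βγ − h_αγ` (product rule and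
`D(x⁻¹)|_{x=1} h = −h`, Mathlib's `hasFDerivAt_ringInverse`). "The differential of the coboundary
at the identity is well known to be (A.5) `{h_αβ} → {h_αβ + h_βγ − h_αγ}`" (p. 249).
[cite: DeMichelisFreedman1992, App. A (A.5), p. 249] -/
theorem hasFDerivAt_cechCoboundary_apply (α β γ : ι) :
    HasFDerivAt (fun g : ι → ι → 𝔸 ↦ cechCoboundary g α β γ)
      (cochainEntry 𝕜 α β + cochainEntry 𝕜 β γ - cochainEntry 𝕜 α γ) 1 := by
  have h1 : HasFDerivAt (fun g : ι → ι → 𝔸 ↦ g α β) (cochainEntry 𝕜 α β) 1 :=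
    hasFDerivAt_cochainEntry α β 1
  have h2 : HasFDerivAt (fun g : ι → ι → 𝔸 ↦ g β γ) (cochainEntry 𝕜 β γ) 1 :=
    hasFDerivAt_cochainEntry β γ 1
  have h3 : HasFDerivAt (fun g : ι → ι → 𝔸 ↦ Ring.inverse (g α γ))
      ((-ContinuousLinearMap.mulLeftRight 𝕜 𝔸 ↑(1 : 𝔸ˣ)⁻¹ ↑(1 : 𝔸ˣ)⁻¹).comp (cochainEntry 𝕜 α γ)) 1 := by
    have hi := hasFDerivAt_ringInverse (𝕜 := 𝕜) (1 : 𝔸ˣ)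
    have hpt : ((1 : 𝔸ˣ) : 𝔸) = (fun g : ι → ι → 𝔸 ↦ g α γ) 1 := by simp
    rw [hpt] at hi
    exact hi.comp (1 : ι → ι → 𝔸) (hasFDerivAt_cochainEntry (𝕜 := 𝕜) α γ 1)
  refine ((h1.mul' h2).mul' h3).congr_fderiv ?_
  ext v
  simp
  abel

/-- **(A.5)**: the Fréchet derivative of the nonabelian Čech coboundary `δ` at the identity
cochain is the abelian Čech coboundary `cechCoboundaryDeriv`, `{h_αβ} ↦ {h_αβ + h_βγ − h_αγ}`.
[cite: DeMichelisFreedman1992, App. A (A.5), p. 249] -/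
theorem hasFDerivAt_cechCoboundary :
    HasFDerivAt (cechCoboundary : (ι → ι → 𝔸) → ι → ι → ι → 𝔸) (cechCoboundaryDeriv 𝕜) 1 :=
  hasFDerivAt_pi'' fun α ↦ hasFDerivAt_pi'' fun β ↦ hasFDerivAt_pi'' fun γ ↦
    hasFDerivAt_cechCoboundary_apply α β γ

end CechCoboundary

end Literature.Barriers.SmoothPoincare4
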